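import Mathlib
import HarnessLib
import Summits.HubbardSuperconductivity.HubbardSuperconductivity.Theorems.KLProgrammeFermiSurfaceTwoLoopLevel
import Summits.HubbardSuperconductivity.HubbardSuperconductivity.Theorems.KLProgrammeFermiSurfaceTwoLoopWindow

/-!
# Route `KLProgramme` (cruxes K3/K1, risk r2) — FST II Theorem 1.1 (two-loop volume) for the Hubbard band, part 3:
# the outer estimate near the doubled Fermi curve `2S_μ + c + 2πℤ²` is `O(√s)`

Cell `gate-hubbard-kl`, seat fs-1 (g5), risk-register item r2; continues `KLProgrammeFermiSurfaceTwoLoopLevel.lean` (level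
function `G_c`, trichotomy, joint continuity) and `…TwoLoopWindow.lean` (window lemmas). Contents:

* `kltl_exists_modulus` — by compactness of `[a, b] × [0, 4π]² × [-π, 5π]` (every `(c, θ₀)` reduces to it by the
  periodicities of `G`), an `m > 0` with `|G| + |G'| + |G''| ≥ m` (positive by the trichotomy) and a window size `ℓ` on
  which `G`, `G'` oscillate by `< m/6` (uniform continuity); constants are existential;
* `kltl_exists_volume_level_sublevel_le` — `vol{θ ∈ [θ₀, θ₀ + 2π] : |G_c(θ)| ≤ δ} ≤ D√δ` for all `δ > 0`, uniformly in
  `μ ∈ [a, b]`, `c ∈ ℝ²`, `θ₀`: cover a period by `N + 1` windows of width `< ℓ` and apply the window lemma on each;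
* `kltl_exists_volume_nearCaustic_le` — **caustic side of the outer variable**: for `τ = ±1`, any `q`, any period and
  `s > 0`, the parameters `θ` with `τ p_μ(θ) + q` within sup-distance `s` of `2 p_μ(φ) + 2πm` for some `φ, m` form a set
  of measure `≤ D√s` — such `θ` has `|G_{c'}(θ)| ≤ 2s` for one of four shifts `c' = -τq - 2πσ`, `σ ∈ {0, 1}²`
  (`kltl_nearCaustic_subset`; halving a `2πm`-translate costs the sign `(-1)^m` on each cosine, `kltl_cos_half_translate`).

No definitions; everything PROVED. [folklore]
-/

noncomputable section

open Real Set MeasureTheory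
open scoped ENNReal

-- the tree's namespace `Summit.<Summit>.<Problem>.Theorems` repeats the summit name by design (D-0017)
set_option linter.dupNamespace false

namespace Summit.HubbardSuperconductivity.HubbardSuperconductivity.Theorems

open Literature.MathematicalPhysics.QuantumLattice
open Literature.MathematicalPhysics.QuantumLattice.BandSectorCounting

/-! ### §5 Compactness: a uniform lower bound `m` on `|G| + |G'| + |G''|` and a modulus `ℓ` for `G, G'` -/

section Modulus

variable {a b : ℝ} (ha : -4 < a) (hab : a ≤ b) (hb : b < 0)
include ha hab hb

/-- **The modulus of the three-leg caustic.** There are `m, ℓ > 0` such that for every level `μ ∈ [a, b]`, every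
`c ∈ [0, 4π]²` and every `θ ∈ [-π, 5π]`: `m ≤ |G_c(θ)| + |G_c'(θ)| + |G_c''(θ)|`, and `|G_c(θ') - G_c(θ)| < m/6`,
`|G_c'(θ') - G_c'(θ)| < m/6` whenever `θ' ∈ [-π, 5π]`, `|θ' - θ| ≤ ℓ`. [folklore] -/
theorem kltl_exists_modulus :
    ∃ m ℓ : ℝ, 0 < m ∧ 0 < ℓ ∧ ∀ μ ∈ Icc a b, ∀ c₁ ∈ Icc (0 : ℝ) (4 * π), ∀ c₂ ∈ Icc (0 : ℝ) (4 * π),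
      ∀ θ ∈ Icc (-π) (5 * π),
        m ≤ |klTwoLoopLevel μ c₁ c₂ θ| + |klTwoLoopLevelDeriv μ c₁ c₂ θ| + |klTwoLoopLevelDeriv₂ μ c₁ c₂ θ| ∧
        ∀ θ' ∈ Icc (-π) (5 * π), |θ' - θ| ≤ ℓ →
          |klTwoLoopLevel μ c₁ c₂ θ' - klTwoLoopLevel μ c₁ c₂ θ| < m / 6 ∧
          |klTwoLoopLevelDeriv μ c₁ c₂ θ' - klTwoLoopLevelDeriv μ c₁ c₂ θ| < m / 6 := by
  obtain ⟨K, hK⟩ : ∃ K : Set (ℝ × ℝ × ℝ × ℝ),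
      K = Icc a b ×ˢ (Icc (0 : ℝ) (4 * π) ×ˢ (Icc (0 : ℝ) (4 * π) ×ˢ Icc (-π) (5 * π))) := ⟨_, rfl⟩
  have hKc : IsCompact K := by
    rw [hK]; exact isCompact_Icc.prod (isCompact_Icc.prod (isCompact_Icc.prod isCompact_Icc))
  have hmemK : ∀ {μ c₁ c₂ θ : ℝ}, μ ∈ Icc a b → c₁ ∈ Icc (0 : ℝ) (4 * π) → c₂ ∈ Icc (0 : ℝ) (4 * π) →
      θ ∈ Icc (-π) (5 * π) → ((μ, c₁, c₂, θ) : ℝ × ℝ × ℝ × ℝ) ∈ K := by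
    intro μ c₁ c₂ θ hμ hc₁ hc₂ hθ
    rw [hK]; exact ⟨hμ, hc₁, hc₂, hθ⟩
  have hKU : K ⊆ {p : ℝ × ℝ × ℝ × ℝ | p.1 ∈ Ioo (-4 : ℝ) 0} := by
    intro p hp; rw [hK] at hp; exact ⟨ha.trans_le hp.1.1, hp.1.2.trans_lt hb⟩
  have hπ := Real.pi_pos
  have hKne : K.Nonempty :=
    ⟨(a, 0, 0, 0), hmemK ⟨le_rfl, hab⟩ ⟨le_rfl, by positivity⟩ ⟨le_rfl, by positivity⟩ ⟨by linarith, by positivity⟩⟩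
  -- the three functions on the bundle and the sum of their absolute values
  have hGc := kltl_continuousOn_level.mono hKU
  have hG₁c := kltl_continuousOn_levelDeriv.mono hKU
  have hG₂c := kltl_continuousOn_levelDeriv₂.mono hKU
  obtain ⟨F, hF⟩ : ∃ F : ℝ × ℝ × ℝ × ℝ → ℝ, F = fun p =>
      |klTwoLoopLevel p.1 p.2.1 p.2.2.1 p.2.2.2| + |klTwoLoopLevelDeriv p.1 p.2.1 p.2.2.1 p.2.2.2| +
        |klTwoLoopLevelDeriv₂ p.1 p.2.1 p.2.2.1 p.2.2.2| := ⟨_, rfl⟩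
  have hFc : ContinuousOn F K := by rw [hF]; exact (hGc.abs.add hG₁c.abs).add hG₂c.abs
  obtain ⟨p₀, hp₀, hmin⟩ := hKc.exists_isMinOn hKne hFc
  have hFp₀ : F p₀ = |klTwoLoopLevel p₀.1 p₀.2.1 p₀.2.2.1 p₀.2.2.2| + |klTwoLoopLevelDeriv p₀.1 p₀.2.1 p₀.2.2.1 p₀.2.2.2| +
      |klTwoLoopLevelDeriv₂ p₀.1 p₀.2.1 p₀.2.2.1 p₀.2.2.2| := by rw [hF]
  have hm : 0 < F p₀ := by
    by_contra hle
    have hle : F p₀ ≤ 0 := le_of_not_gt hle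
    rw [hFp₀] at hle
    have ha0 := abs_nonneg (klTwoLoopLevel p₀.1 p₀.2.1 p₀.2.2.1 p₀.2.2.2)
    have ha1 := abs_nonneg (klTwoLoopLevelDeriv p₀.1 p₀.2.1 p₀.2.2.1 p₀.2.2.2)
    have ha2 := abs_nonneg (klTwoLoopLevelDeriv₂ p₀.1 p₀.2.1 p₀.2.2.1 p₀.2.2.2)
    have h0 : klTwoLoopLevel p₀.1 p₀.2.1 p₀.2.2.1 p₀.2.2.2 = 0 := abs_nonpos_iff.1 (by linarith)
    have h1 : klTwoLoopLevelDeriv p₀.1 p₀.2.1 p₀.2.2.1 p₀.2.2.2 = 0 := abs_nonpos_iff.1 (by linarith)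
    have h2 : klTwoLoopLevelDeriv₂ p₀.1 p₀.2.1 p₀.2.2.1 p₀.2.2.2 = 0 := abs_nonpos_iff.1 (by linarith)
    have hμ₀ := hKU hp₀
    exact kltl_levelDeriv₂_ne_zero hμ₀.1 hμ₀.2 h0 h1 h2
  -- uniform continuity of `G` and `G'` on `K`
  have hm6 : 0 < F p₀ / 6 := by positivity
  obtain ⟨δ₀, hδ₀, hδ₀G⟩ := Metric.uniformContinuousOn_iff.1 (hKc.uniformContinuousOn_of_continuous hGc) _ hm6
  obtain ⟨δ₁, hδ₁, hδ₁G⟩ := Metric.uniformContinuousOn_iff.1 (hKc.uniformContinuousOn_of_continuous hG₁c) _ hm6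
  refine ⟨F p₀, min δ₀ δ₁ / 2, hm, by positivity, ?_⟩
  intro μ hμ c₁ hc₁ c₂ hc₂ θ hθ
  have hp : ((μ, c₁, c₂, θ) : ℝ × ℝ × ℝ × ℝ) ∈ K := hmemK hμ hc₁ hc₂ hθ
  have hle : F p₀ ≤ F (μ, c₁, c₂, θ) := (isMinOn_iff.1 hmin) _ hp
  have hFp : F (μ, c₁, c₂, θ) = |klTwoLoopLevel μ c₁ c₂ θ| + |klTwoLoopLevelDeriv μ c₁ c₂ θ| +
      |klTwoLoopLevelDeriv₂ μ c₁ c₂ θ| := by rw [hF]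
  refine ⟨hFp ▸ hle, fun θ' hθ' hθθ => ?_⟩
  have hp' : ((μ, c₁, c₂, θ') : ℝ × ℝ × ℝ × ℝ) ∈ K := hmemK hμ hc₁ hc₂ hθ'
  have hdist : dist ((μ, c₁, c₂, θ') : ℝ × ℝ × ℝ × ℝ) (μ, c₁, c₂, θ) = |θ' - θ| := by
    simp [Prod.dist_eq, dist_self, Real.dist_eq]
  have hd₀ : dist ((μ, c₁, c₂, θ') : ℝ × ℝ × ℝ × ℝ) (μ, c₁, c₂, θ) < δ₀ := by rw [hdist]; linarith [min_le_left δ₀ δ₁]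
  have hd₁ : dist ((μ, c₁, c₂, θ') : ℝ × ℝ × ℝ × ℝ) (μ, c₁, c₂, θ) < δ₁ := by rw [hdist]; linarith [min_le_right δ₀ δ₁]
  have e₀ := hδ₀G _ hp' _ hp hd₀
  have e₁ := hδ₁G _ hp' _ hp hd₁
  rw [Real.dist_eq] at e₀ e₁
  exact ⟨e₀, e₁⟩

end Modulus

/-! ### §7 The sublevel sets of `G_c` have measure `O(√δ)`, uniformly in `μ ∈ [a, b]`, `c`, and the period -/

section Sqrt

variable {a b : ℝ} (ha : -4 < a) (hab : a ≤ b) (hb : b < 0)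
include ha hab hb

omit hab in
/-- Reduced case: `c ∈ [0, 4π)²`, `θ₀ ∈ [-π, π]`, `0 < δ ≤ min 1 (m/6)`. [folklore] -/
theorem kltl_volume_level_sublevel_le_reduced {m ℓ : ℝ} (hm : 0 < m) (hℓ : 0 < ℓ)
    (hmod : ∀ μ ∈ Icc a b, ∀ c₁ ∈ Icc (0 : ℝ) (4 * π), ∀ c₂ ∈ Icc (0 : ℝ) (4 * π), ∀ θ ∈ Icc (-π) (5 * π),
        m ≤ |klTwoLoopLevel μ c₁ c₂ θ| + |klTwoLoopLevelDeriv μ c₁ c₂ θ| + |klTwoLoopLevelDeriv₂ μ c₁ c₂ θ| ∧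
        ∀ θ' ∈ Icc (-π) (5 * π), |θ' - θ| ≤ ℓ →
          |klTwoLoopLevel μ c₁ c₂ θ' - klTwoLoopLevel μ c₁ c₂ θ| < m / 6 ∧
          |klTwoLoopLevelDeriv μ c₁ c₂ θ' - klTwoLoopLevelDeriv μ c₁ c₂ θ| < m / 6)
    {N : ℕ} (hN : N = ⌊2 * π / ℓ⌋₊ + 1)
    {μ : ℝ} (hμ : μ ∈ Icc a b) {c₁ c₂ : ℝ} (hc₁ : c₁ ∈ Icc (0 : ℝ) (4 * π)) (hc₂ : c₂ ∈ Icc (0 : ℝ) (4 * π))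
    {θ₀ : ℝ} (hθ₀ : θ₀ ∈ Icc (-π) π) {δ : ℝ} (hδ : 0 < δ) (hδm : δ ≤ m / 6) :
    volume {θ ∈ Icc θ₀ (θ₀ + 2 * π) | |klTwoLoopLevel μ c₁ c₂ θ| ≤ δ} ≤
      ENNReal.ofReal (((N : ℝ) + 1) * (6 * Real.sqrt (3 * δ / m) + 12 * δ / m)) := by
  have hπ := Real.pi_pos
  have hμ₁ : -4 < μ := ha.trans_le hμ.1
  have hμ₂ : μ < 0 := hμ.2.trans_lt hb
  -- the window width
  have hN0 : (0 : ℝ) < N := by rw [hN]; positivity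
  have hNgt : 2 * π / ℓ < N := by rw [hN]; push_cast; exact Nat.lt_floor_add_one _
  set w : ℝ := 2 * π / N with hw
  have hw0 : 0 < w := by positivity
  have hwℓ : w ≤ ℓ := by
    rw [hw, div_le_iff₀ hN0]
    have := (div_lt_iff₀ hℓ).1 hNgt
    linarith
  have hNw : (N : ℝ) * w = 2 * π := by rw [hw]; field_simp
  have hw2π : w ≤ 2 * π := by
    have h1 : (1 : ℝ) ≤ N := by rw [hN]; push_cast; linarith [show (0:ℝ) ≤ ⌊2 * π / ℓ⌋₊ from Nat.cast_nonneg _]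
    rw [hw, div_le_iff₀ hN0]; nlinarith
  -- the windows
  set W : ℕ → Set ℝ := fun i => Icc (θ₀ + i * w) (θ₀ + (i + 1) * w) with hW
  have hcover : {θ ∈ Icc θ₀ (θ₀ + 2 * π) | |klTwoLoopLevel μ c₁ c₂ θ| ≤ δ} ⊆
      ⋃ i ∈ Finset.range (N + 1), {θ ∈ W i | |klTwoLoopLevel μ c₁ c₂ θ| ≤ δ} := by
    rintro θ ⟨hθ, hP⟩
    have ht0 : 0 ≤ (θ - θ₀) / w := div_nonneg (by linarith [hθ.1]) hw0.le
    set i : ℕ := ⌊(θ - θ₀) / w⌋₊ with hi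
    have hi1 : (i : ℝ) ≤ (θ - θ₀) / w := Nat.floor_le ht0
    have hi2 : (θ - θ₀) / w < i + 1 := Nat.lt_floor_add_one _
    have hiN : i < N + 1 := by
      have : (i : ℝ) ≤ N := by
        refine hi1.trans ?_
        rw [div_le_iff₀ hw0, hNw]; linarith [hθ.2]
      exact_mod_cast Nat.lt_succ_of_le (by exact_mod_cast this : i ≤ N)
    refine mem_iUnion₂.2 ⟨i, Finset.mem_range.2 hiN, ⟨?_, ?_⟩, hP⟩
    · have := (le_div_iff₀ hw0).1 hi1; linarith
    · have := (div_lt_iff₀ hw0).1 hi2; linarith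
  -- each window lies in the box and satisfies the window lemma
  have hWsub : ∀ i ∈ Finset.range (N + 1), W i ⊆ Icc (-π) (5 * π) := by
    intro i hi t ht
    have hi' : (i : ℝ) ≤ N := by exact_mod_cast Nat.le_of_lt_succ (Finset.mem_range.1 hi)
    have h0i : (0 : ℝ) ≤ i := Nat.cast_nonneg i
    constructor
    · have : 0 ≤ (i : ℝ) * w := by positivity
      linarith [ht.1, hθ₀.1]
    · have : ((i : ℝ) + 1) * w ≤ 2 * π + w := by nlinarith
      linarith [ht.2, hθ₀.2]
  have hwin : ∀ i ∈ Finset.range (N + 1),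
      volume {θ ∈ W i | |klTwoLoopLevel μ c₁ c₂ θ| ≤ δ} ≤
        ENNReal.ofReal (6 * Real.sqrt (3 * δ / m) + 12 * δ / m) := by
    intro i hi
    have hWi := hWsub i hi
    refine kltl_volume_window_le (kltl_hasDerivAt_level hμ₁ hμ₂ c₁ c₂)
      (kltl_hasDerivAt_levelDeriv hμ₁ hμ₂ c₁ c₂) hm hδ hδm
      (fun t ht => (hmod μ hμ c₁ hc₁ c₂ hc₂ t (hWi ht)).1) (fun t ht t' ht' => ?_) (fun t ht t' ht' => ?_)
    · refine ((hmod μ hμ c₁ hc₁ c₂ hc₂ t (hWi ht)).2 t' (hWi ht') ?_).1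
      rw [abs_le]; constructor <;> nlinarith [ht.1, ht.2, ht'.1, ht'.2]
    · refine ((hmod μ hμ c₁ hc₁ c₂ hc₂ t (hWi ht)).2 t' (hWi ht') ?_).2
      rw [abs_le]; constructor <;> nlinarith [ht.1, ht.2, ht'.1, ht'.2]
  -- sum
  have hb0 : 0 ≤ 6 * Real.sqrt (3 * δ / m) + 12 * δ / m := by positivity
  calc volume {θ ∈ Icc θ₀ (θ₀ + 2 * π) | |klTwoLoopLevel μ c₁ c₂ θ| ≤ δ}
      ≤ volume (⋃ i ∈ Finset.range (N + 1), {θ ∈ W i | |klTwoLoopLevel μ c₁ c₂ θ| ≤ δ}) := measure_mono hcover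
    _ ≤ ∑ i ∈ Finset.range (N + 1), volume {θ ∈ W i | |klTwoLoopLevel μ c₁ c₂ θ| ≤ δ} :=
        measure_biUnion_finset_le _ _
    _ ≤ ∑ i ∈ Finset.range (N + 1), ENNReal.ofReal (6 * Real.sqrt (3 * δ / m) + 12 * δ / m) :=
        Finset.sum_le_sum hwin
    _ = ENNReal.ofReal (((N : ℝ) + 1) * (6 * Real.sqrt (3 * δ / m) + 12 * δ / m)) := by
        rw [Finset.sum_const, Finset.card_range, nsmul_eq_mul, ENNReal.ofReal_mul (by positivity)]
        congr 1
        rw [show ((N : ℝ) + 1) = ((N + 1 : ℕ) : ℝ) by push_cast; ring, ENNReal.ofReal_natCast]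

/-- **The outer caustic estimate, level-function form.** There is `D > 0` such that for every `μ ∈ [a, b]`, every
`c ∈ ℝ²`, every period `[θ₀, θ₀ + 2π]` and every `δ > 0`: `vol{θ : |G_c(θ)| ≤ δ} ≤ D √δ`. [folklore] -/
theorem kltl_exists_volume_level_sublevel_le :
    ∃ D : ℝ, 0 < D ∧ ∀ μ ∈ Icc a b, ∀ c₁ c₂ θ₀ δ : ℝ, 0 < δ →
      volume {θ ∈ Icc θ₀ (θ₀ + 2 * π) | |klTwoLoopLevel μ c₁ c₂ θ| ≤ δ} ≤ ENNReal.ofReal (D * Real.sqrt δ) := by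
  have hπ := Real.pi_pos
  obtain ⟨m, ℓ, hm, hℓ, hmod⟩ := kltl_exists_modulus ha hab hb
  obtain ⟨N, hN⟩ : ∃ N : ℕ, N = ⌊2 * π / ℓ⌋₊ + 1 := ⟨_, rfl⟩
  set δ₀ : ℝ := min 1 (m / 6) with hδ₀
  have hδ₀0 : 0 < δ₀ := lt_min one_pos (by positivity)
  set D : ℝ := ((N : ℝ) + 1) * (6 * Real.sqrt (3 / m) + 12 / m) + 2 * π / Real.sqrt δ₀ with hD
  have hD1 : 0 ≤ ((N : ℝ) + 1) * (6 * Real.sqrt (3 / m) + 12 / m) := by positivity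
  have hD2 : 0 < 2 * π / Real.sqrt δ₀ := by positivity
  refine ⟨D, by positivity, fun μ hμ c₁ c₂ θ₀ δ hδ => ?_⟩
  have hμ₁ : -4 < μ := ha.trans_le hμ.1
  have hμ₂ : μ < 0 := hμ.2.trans_lt hb
  have hsqδ : 0 < Real.sqrt δ := Real.sqrt_pos.2 hδ
  rcases le_or_gt δ δ₀ with hsmall | hlarge
  · -- reduce `(c, θ₀)` into the box
    have hδ1 : δ ≤ 1 := hsmall.trans (min_le_left _ _)
    have hδm : δ ≤ m / 6 := hsmall.trans (min_le_right _ _)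
    obtain ⟨n₀, hn₀⟩ : ∃ n : ℤ, n = ⌊c₁ / (4 * π)⌋ := ⟨_, rfl⟩
    obtain ⟨n₁, hn₁⟩ : ∃ n : ℤ, n = ⌊c₂ / (4 * π)⌋ := ⟨_, rfl⟩
    obtain ⟨k, hk⟩ : ∃ k : ℤ, k = ⌊(θ₀ + π) / (2 * π)⌋ := ⟨_, rfl⟩
    set c₁' := c₁ - n₀ * (4 * π) with hc₁'
    set c₂' := c₂ - n₁ * (4 * π) with hc₂'
    set θ₀' := θ₀ - k * (2 * π) with hθ₀'
    have h4π : 0 < 4 * π := by positivity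
    have hc₁I : c₁' ∈ Icc (0 : ℝ) (4 * π) := by
      have h1 : (n₀ : ℝ) ≤ c₁ / (4 * π) := by rw [hn₀]; exact Int.floor_le _
      have h2 : c₁ / (4 * π) < n₀ + 1 := by rw [hn₀]; exact Int.lt_floor_add_one _
      rw [le_div_iff₀ h4π] at h1; rw [div_lt_iff₀ h4π] at h2
      exact ⟨by rw [hc₁']; linarith, by rw [hc₁']; linarith⟩
    have hc₂I : c₂' ∈ Icc (0 : ℝ) (4 * π) := by
      have h1 : (n₁ : ℝ) ≤ c₂ / (4 * π) := by rw [hn₁]; exact Int.floor_le _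
      have h2 : c₂ / (4 * π) < n₁ + 1 := by rw [hn₁]; exact Int.lt_floor_add_one _
      rw [le_div_iff₀ h4π] at h1; rw [div_lt_iff₀ h4π] at h2
      exact ⟨by rw [hc₂']; linarith, by rw [hc₂']; linarith⟩
    have hθ₀I : θ₀' ∈ Icc (-π) π := by
      have h2π : 0 < 2 * π := by positivity
      have h1 : (k : ℝ) ≤ (θ₀ + π) / (2 * π) := by rw [hk]; exact Int.floor_le _
      have h2 : (θ₀ + π) / (2 * π) < k + 1 := by rw [hk]; exact Int.lt_floor_add_one _
      rw [le_div_iff₀ h2π] at h1; rw [div_lt_iff₀ h2π] at h2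
      exact ⟨by rw [hθ₀']; linarith, by rw [hθ₀']; linarith⟩
    -- the sublevel set is a translate of the reduced one
    have hset : {θ ∈ Icc θ₀ (θ₀ + 2 * π) | |klTwoLoopLevel μ c₁ c₂ θ| ≤ δ} =
        (fun θ => θ + (-(k * (2 * π)))) ⁻¹' {θ ∈ Icc θ₀' (θ₀' + 2 * π) | |klTwoLoopLevel μ c₁' c₂' θ| ≤ δ} := by
      ext θ
      simp only [mem_setOf_eq, mem_preimage, mem_Icc]
      have hper : klTwoLoopLevel μ c₁' c₂' (θ + -(k * (2 * π))) = klTwoLoopLevel μ c₁ c₂ θ := by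
        have h1 := kltl_level_add_int_mul_two_pi hμ₁ hμ₂ c₁' c₂' (θ + -(k * (2 * π))) k
        rw [show θ + -(k * (2 * π)) + k * (2 * π) = θ by ring] at h1
        rw [← h1, hc₁', hc₂', kltl_level_sub_int_mul_four_pi]
      rw [hper, hθ₀']
      constructor
      · rintro ⟨⟨h1, h2⟩, h3⟩; exact ⟨⟨by linarith, by linarith⟩, h3⟩
      · rintro ⟨⟨h1, h2⟩, h3⟩; exact ⟨⟨by linarith, by linarith⟩, h3⟩
    rw [hset, measure_preimage_add_right]
    refine (kltl_volume_level_sublevel_le_reduced ha hb hm hℓ hmod hN hμ hc₁I hc₂I hθ₀I hδ hδm).trans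
      (ENNReal.ofReal_le_ofReal ?_)
    -- `(N+1)(6√(3δ/m) + 12δ/m) ≤ D √δ`
    have hsq3 : Real.sqrt (3 * δ / m) = Real.sqrt (3 / m) * Real.sqrt δ := by
      rw [← Real.sqrt_mul (by positivity)]; congr 1; ring
    have hδsq : δ ≤ Real.sqrt δ := by
      have h := Real.sqrt_le_sqrt hδ1
      rw [Real.sqrt_one] at h
      calc δ = Real.sqrt δ * Real.sqrt δ := (Real.mul_self_sqrt hδ.le).symm
        _ ≤ Real.sqrt δ * 1 := mul_le_mul_of_nonneg_left h hsqδ.le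
        _ = Real.sqrt δ := mul_one _
    have h1 : 6 * Real.sqrt (3 * δ / m) + 12 * δ / m ≤ (6 * Real.sqrt (3 / m) + 12 / m) * Real.sqrt δ := by
      rw [hsq3, add_mul]
      have : 12 * δ / m ≤ 12 / m * Real.sqrt δ := by
        rw [div_mul_eq_mul_div, div_le_div_iff_of_pos_right hm]; nlinarith
      linarith
    calc ((N : ℝ) + 1) * (6 * Real.sqrt (3 * δ / m) + 12 * δ / m)
        ≤ ((N : ℝ) + 1) * ((6 * Real.sqrt (3 / m) + 12 / m) * Real.sqrt δ) := by gcongr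
      _ = (((N : ℝ) + 1) * (6 * Real.sqrt (3 / m) + 12 / m)) * Real.sqrt δ := by ring
      _ ≤ D * Real.sqrt δ := by rw [hD]; nlinarith
  · -- large `δ`: the trivial bound `2π`
    have htriv : volume {θ ∈ Icc θ₀ (θ₀ + 2 * π) | |klTwoLoopLevel μ c₁ c₂ θ| ≤ δ} ≤ ENNReal.ofReal (2 * π) := by
      calc volume {θ ∈ Icc θ₀ (θ₀ + 2 * π) | |klTwoLoopLevel μ c₁ c₂ θ| ≤ δ} ≤ volume (Icc θ₀ (θ₀ + 2 * π)) :=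
            measure_mono fun θ hθ => hθ.1
        _ = ENNReal.ofReal (2 * π) := by rw [Real.volume_Icc]; congr 1; ring
    refine htriv.trans (ENNReal.ofReal_le_ofReal ?_)
    have hs : Real.sqrt δ₀ ≤ Real.sqrt δ := Real.sqrt_le_sqrt hlarge.le
    have hs0 : 0 < Real.sqrt δ₀ := Real.sqrt_pos.2 hδ₀0
    calc 2 * π = 2 * π / Real.sqrt δ₀ * Real.sqrt δ₀ := by field_simp
      _ ≤ 2 * π / Real.sqrt δ₀ * Real.sqrt δ := by gcongr
      _ ≤ D * Real.sqrt δ := by rw [hD]; nlinarith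

end Sqrt

/-! ### §8 Near the doubled curve: the angular measure within sup-distance `s` of `2S_μ + c + 2πℤ²` is `O(√s)` -/

/-- Halving a lattice translate: `cos((τz + q - 2πm)/2) = cos((z - c')/2)` with `c' = -τq - 2πσ`, `σ ∈ {0, 1}` the
parity of `m` (`τ = ±1`). [folklore] -/
theorem kltl_cos_half_translate {τ : ℝ} (hτ : τ = 1 ∨ τ = -1) (z q : ℝ) (m : ℤ) :
    ∃ σ : ℝ, (σ = 0 ∨ σ = 1) ∧
      Real.cos ((τ * z + q - m * (2 * π)) / 2) = Real.cos ((z - (-τ * q - σ * (2 * π))) / 2) := by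
  rcases Int.even_or_odd' m with ⟨n, rfl | rfl⟩ <;> rcases hτ with rfl | rfl
  · refine ⟨0, Or.inl rfl, ?_⟩
    rw [show ((1 : ℝ) * z + q - ((2 * n : ℤ) : ℝ) * (2 * π)) / 2 = (z - (-1 * q - 0 * (2 * π))) / 2 - n * (2 * π) by
      push_cast; ring, Real.cos_sub_int_mul_two_pi]
  · refine ⟨0, Or.inl rfl, ?_⟩
    rw [show ((-1 : ℝ) * z + q - ((2 * n : ℤ) : ℝ) * (2 * π)) / 2 = -((z - (-(-1) * q - 0 * (2 * π))) / 2) - n * (2 * π) by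
      push_cast; ring, Real.cos_sub_int_mul_two_pi, Real.cos_neg]
  · refine ⟨1, Or.inr rfl, ?_⟩
    rw [show ((1 : ℝ) * z + q - ((2 * n + 1 : ℤ) : ℝ) * (2 * π)) / 2 = ((z + q) / 2 - π) - n * (2 * π) by
      push_cast; ring, Real.cos_sub_int_mul_two_pi, Real.cos_sub_pi,
      show (z - (-1 * q - 1 * (2 * π))) / 2 = (z + q) / 2 + π by ring, Real.cos_add_pi]
  · refine ⟨1, Or.inr rfl, ?_⟩
    rw [show ((-1 : ℝ) * z + q - ((2 * n + 1 : ℤ) : ℝ) * (2 * π)) / 2 = (-((z - q) / 2) - π) - n * (2 * π) by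
      push_cast; ring, Real.cos_sub_int_mul_two_pi, Real.cos_sub_pi, Real.cos_neg,
      show (z - (-(-1) * q - 1 * (2 * π))) / 2 = (z - q) / 2 + π by ring, Real.cos_add_pi]

section Caustic

variable {μ : ℝ} (hμ₁ : -4 < μ) (hμ₂ : μ < 0)
include hμ₁ hμ₂

/-- **Reduction.** The near-caustic set is contained in the union of four sublevel sets `{|G_{c'}| ≤ 2s}`. [folklore] -/
theorem kltl_nearCaustic_subset {τ : ℝ} (hτ : τ = 1 ∨ τ = -1) (q₁ q₂ s : ℝ) (P : Set ℝ) :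
    {θ ∈ P | ∃ m₀ m₁ : ℤ, ∃ φ : ℝ,
        max |τ * bandX μ θ + q₁ - m₀ * (2 * π) - 2 * bandX μ φ| |τ * bandY μ θ + q₂ - m₁ * (2 * π) - 2 * bandY μ φ| < s} ⊆
      ({θ ∈ P | |klTwoLoopLevel μ (-τ * q₁ - 0 * (2 * π)) (-τ * q₂ - 0 * (2 * π)) θ| ≤ 2 * s} ∪
        {θ ∈ P | |klTwoLoopLevel μ (-τ * q₁ - 0 * (2 * π)) (-τ * q₂ - 1 * (2 * π)) θ| ≤ 2 * s}) ∪
      ({θ ∈ P | |klTwoLoopLevel μ (-τ * q₁ - 1 * (2 * π)) (-τ * q₂ - 0 * (2 * π)) θ| ≤ 2 * s} ∪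
        {θ ∈ P | |klTwoLoopLevel μ (-τ * q₁ - 1 * (2 * π)) (-τ * q₂ - 1 * (2 * π)) θ| ≤ 2 * s}) := by
  rintro θ ⟨hP, m₀, m₁, φ, hlt⟩
  have hx : |τ * bandX μ θ + q₁ - m₀ * (2 * π) - 2 * bandX μ φ| < s := lt_of_le_of_lt (le_max_left _ _) hlt
  have hy : |τ * bandY μ θ + q₂ - m₁ * (2 * π) - 2 * bandY μ φ| < s := lt_of_le_of_lt (le_max_right _ _) hlt
  obtain ⟨σ₀, hσ₀, hc₀⟩ := kltl_cos_half_translate hτ (bandX μ θ) q₁ m₀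
  obtain ⟨σ₁, hσ₁, hc₁⟩ := kltl_cos_half_translate hτ (bandY μ θ) q₂ m₁
  -- the half point is `s/2`-close to `p_μ(φ)`, so `|G| < 2s`
  have hval : |klTwoLoopLevel μ (-τ * q₁ - σ₀ * (2 * π)) (-τ * q₂ - σ₁ * (2 * π)) θ| ≤ 2 * s := by
    have hG : klTwoLoopLevel μ (-τ * q₁ - σ₀ * (2 * π)) (-τ * q₂ - σ₁ * (2 * π)) θ =
        eps2 ((τ * bandX μ θ + q₁ - m₀ * (2 * π)) / 2) ((τ * bandY μ θ + q₂ - m₁ * (2 * π)) / 2) - μ := by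
      simp only [klTwoLoopLevel, eps2, hc₀, hc₁]
    have hL := abs_eps2_sub_eps2_le ((τ * bandX μ θ + q₁ - m₀ * (2 * π)) / 2) ((τ * bandY μ θ + q₂ - m₁ * (2 * π)) / 2)
      (bandX μ φ) (bandY μ φ)
    rw [eps2_bandXY hμ₁ hμ₂ φ] at hL
    have h1 : |(τ * bandX μ θ + q₁ - m₀ * (2 * π)) / 2 - bandX μ φ| < s / 2 := by
      rw [show (τ * bandX μ θ + q₁ - m₀ * (2 * π)) / 2 - bandX μ φ =
        (τ * bandX μ θ + q₁ - m₀ * (2 * π) - 2 * bandX μ φ) / 2 by ring, abs_div, abs_two]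
      linarith
    have h2 : |(τ * bandY μ θ + q₂ - m₁ * (2 * π)) / 2 - bandY μ φ| < s / 2 := by
      rw [show (τ * bandY μ θ + q₂ - m₁ * (2 * π)) / 2 - bandY μ φ =
        (τ * bandY μ θ + q₂ - m₁ * (2 * π) - 2 * bandY μ φ) / 2 by ring, abs_div, abs_two]
      linarith
    rw [hG]
    linarith
  rcases hσ₀ with rfl | rfl <;> rcases hσ₁ with rfl | rfl
  · exact Or.inl (Or.inl ⟨hP, hval⟩)
  · exact Or.inl (Or.inr ⟨hP, hval⟩)
  · exact Or.inr (Or.inl ⟨hP, hval⟩)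
  · exact Or.inr (Or.inr ⟨hP, hval⟩)

end Caustic

section CausticMain

variable {a b : ℝ} (ha : -4 < a) (hab : a ≤ b) (hb : b < 0)
include ha hab hb

/-- **Near the doubled curve.** There is `D > 0` such that for every `μ ∈ [a, b]`, every sign `τ = ±1`, every shift
`q`, every period and every `s > 0`: the set of parameters `θ ∈ [θ₀, θ₀ + 2π]` for which `τ p_μ(θ) + q` lies within
sup-distance `s` of the caustic `2S_μ + 2πℤ²` has measure `≤ D √s`. [folklore] -/
theorem kltl_exists_volume_nearCaustic_le :
    ∃ D : ℝ, 0 < D ∧ ∀ μ ∈ Icc a b, ∀ τ : ℝ, (τ = 1 ∨ τ = -1) → ∀ q₁ q₂ θ₀ s : ℝ, 0 < s →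
      volume {θ ∈ Icc θ₀ (θ₀ + 2 * π) | ∃ m₀ m₁ : ℤ, ∃ φ : ℝ,
          max |τ * bandX μ θ + q₁ - m₀ * (2 * π) - 2 * bandX μ φ|
            |τ * bandY μ θ + q₂ - m₁ * (2 * π) - 2 * bandY μ φ| < s} ≤ ENNReal.ofReal (D * Real.sqrt s) := by
  obtain ⟨D, hD, hvol⟩ := kltl_exists_volume_level_sublevel_le ha hab hb
  refine ⟨4 * D * Real.sqrt 2, by positivity, fun μ hμ τ hτ q₁ q₂ θ₀ s hs => ?_⟩
  have hμ₁ : -4 < μ := ha.trans_le hμ.1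
  have hμ₂ : μ < 0 := hμ.2.trans_lt hb
  have h2s : 0 < 2 * s := by linarith
  have hsq : D * Real.sqrt (2 * s) = D * Real.sqrt 2 * Real.sqrt s := by
    rw [Real.sqrt_mul (by norm_num : (0:ℝ) ≤ 2)]; ring
  have hone : ∀ c₁ c₂ : ℝ, volume {θ ∈ Icc θ₀ (θ₀ + 2 * π) | |klTwoLoopLevel μ c₁ c₂ θ| ≤ 2 * s} ≤
      ENNReal.ofReal (D * Real.sqrt 2 * Real.sqrt s) := fun c₁ c₂ =>
    (hvol μ hμ c₁ c₂ θ₀ (2 * s) h2s).trans (by rw [hsq])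
  have h0 : 0 ≤ D * Real.sqrt 2 * Real.sqrt s := by positivity
  refine (measure_mono (kltl_nearCaustic_subset hμ₁ hμ₂ hτ q₁ q₂ s (Icc θ₀ (θ₀ + 2 * π)))).trans ?_
  refine (measure_union_le _ _).trans ?_
  refine (add_le_add ((measure_union_le _ _).trans (add_le_add (hone _ _) (hone _ _)))
    ((measure_union_le _ _).trans (add_le_add (hone _ _) (hone _ _)))).trans ?_
  rw [← ENNReal.ofReal_add h0 h0, ← ENNReal.ofReal_add (by positivity) (by positivity)]
  exact ENNReal.ofReal_le_ofReal (by nlinarith)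

end CausticMain

end Summit.HubbardSuperconductivity.HubbardSuperconductivity.Theorems

end
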